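import Summits.BirchSwinnertonDyer.BirchSwinnertonDyer.Theorems.KimAtThreeKolyvaginIsogenyTransport
import Summits.BirchSwinnertonDyer.BirchSwinnertonDyer.Theses.KimAtThreeKolyvagin
import Summits.BirchSwinnertonDyer.Rank1Residual.X2.IsogenyQuotientLine
import Literature.NumberTheory.Automorphic.ShimuraCurveRibetTakahashiOptimalModularityProofs
import HarnessLib

/-!
# Route `KimAtThreeKolyvagin` (rung W2): the three cruxes REDUCE to the optimal parametrised curves
# of each isogeny class (items 19075 `DeepLowerAtThree`, 19076 `DeepUpperAtThree`,
# 19077 `ShallowEqDeepAtTorsionFree`)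

Cell `bsd-addord`, seat `bsd-addord-kim3` (gen 9). TOOL FILE: theorems only (no definition, no named
fact, no `sorry`); it closes nothing and books nothing. It settles the route-hygiene point recorded by
the planner (TARGET v6.24 E67, reading of seat w2-c4, 2026-08-26): the three W2 cruxes quantify over
EVERY globally minimal `W` with the `3`-adic tower onto and EVERY newform `f` of `W`, whereas the
kernel rungs of the cell are proved for a curve `W₀` carrying an OPTIMAL modular parametrisation
datum `D₀` (`Λ_{W₀} = c₀ Λ_f`, minimal modular degree — the strong Weil curve of the class, on a
global minimal model). The theorems `deepLowerAtThree_of_forall_optimalDatum`,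
`deepUpperAtThree_of_forall_optimalDatum`, `shallowEqDeepAtTorsionFree_of_forall_optimalDatum` prove

  `(crux restricted to optimal data (W₀, D₀)) → crux`,

so a rung stated per optimal datum IS crux-shaped. Ingredients (all tree theorems): every
`(W, f)` with `f` the newform of `W` admits a datum at the level of `f`
(`nonempty_modularParametrizationData_of_isNewformOf`, BCDT) and an optimal datum on a globally
minimal `ℚ`-isogenous `W₀` with the same newform (`exists_optimalDatum_of_edixhoven`, Edixhoven 1991
Prop. 2 for `c₀ ∈ ℤ`); along the isogeny `W ~ W₀` (degree prime to `3` since `E[3]` is irreducible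
under the tower) the crux BINDERS move (`towerSurjective_of_isIsogenous`,
`finite_sha_iff_of_isIsogenous`, `natCard_torsion_padic_eq_of_isIsogenous`,
`kuriharaVanishingOrder_eq_of_isIsogenous`; the plus-symbol integrality is a datum of `f`) and so do
the crux CONCLUSIONS (`∂`-functionals: `KimAtThreeKolyvaginIsogenyInvariance`; `#Ш[3^∞]`:
`natCard_primaryComponent_sha_eq_of_isIsogenous`) — §1 records the latter as `iff`s at any prime `p`.

References: B. Edixhoven, in *Arithmetic algebraic geometry* (Texel 1989), Progr. Math. 89 (1991),
Prop. 2 [EdixhovenManin1991]; A. Agashe, K. Ribet, W. Stein, Pure Appl. Math. Q. 2 (2006) Thm. 2.2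
[AgasheRibetStein2006]; J. H. Silverman, *AEC* (2009) III.4.11, III.6.4(b), VII.7.2 [SilvermanAEC2009];
C.-H. Kim, arXiv:2505.09121, Thm. 1.1/1.2 [Kim2025RefinedTNC]; cell memo
`run/shared/lean/pub/bsd-addord/kim3/KIM3-PROOF.md` §1, §17.
-/

-- the Theorems namespace of a single-conjunct summit repeats the summit name by design (D-0017)
set_option linter.dupNamespace false

noncomputable section

open scoped Classical MatrixGroups ModularForm
open Function WeierstrassCurve CongruenceSubgroup
open Literature.NumberTheory.EllipticCurves Literature.NumberTheory.EllipticCurves.ModularForms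
open Literature.NumberTheory.Automorphic (nonempty_modularParametrizationData_of_isNewformOf)
open Summit.BirchSwinnertonDyer.BirchSwinnertonDyer.Theses.KimAtThreeKolyvagin
open Summit.BirchSwinnertonDyer.BirchSwinnertonDyer.Theorems.KimAtThreeKolyvaginIsogenyInvariance
open Summit.BirchSwinnertonDyer.BirchSwinnertonDyer.Theorems.KimAtThreeKolyvaginIsogenyTransport

namespace Summit.BirchSwinnertonDyer.BirchSwinnertonDyer.Theorems.KimAtThreeKolyvaginIsogenyCruxes

/-! ### §1 The three crux conclusions are isogeny-class statements -/

section Transport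

variable {W W' : WeierstrassCurve ℚ} [W.IsElliptic] [W'.IsElliptic] [W.IsGloballyMinimal]
  [W'.IsGloballyMinimal] {p : ℕ} [Fact p.Prime] {N : ℕ} (f : CuspForm (Gamma0 N) 2)
  (hiso : IsIsogenous W W') (hirr : W.HasIrreducibleModPGaloisRep p)

include hiso hirr

/-- The conclusion of `DeepLowerAtThree` (at any prime `p`, any cusp form `f`) holds for `W` iff for a
`ℚ`-isogenous `W'`, when `E[p]` is irreducible. [cite: SilvermanAEC2009, Cor. III.4.11 and Cor. VII.7.2] -/
theorem deepLower_conclusion_iff_of_isIsogenous :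
    (∃ d : ℕ, kuriharaPartialDeepInfty W p f = d ∧ kuriharaPartial W p f 0 ≤
        ((padicValNat p (Nat.card (AddCommGroup.primaryComponent W.sha p)) + d : ℕ) : ℕ∞)) ↔
      ∃ d : ℕ, kuriharaPartialDeepInfty W' p f = d ∧ kuriharaPartial W' p f 0 ≤
        ((padicValNat p (Nat.card (AddCommGroup.primaryComponent W'.sha p)) + d : ℕ) : ℕ∞) := by
  rw [kuriharaPartialDeepInfty_eq_of_isIsogenous f hiso hirr, kuriharaPartial_eq_of_isIsogenous f hiso
    hirr 0, natCard_primaryComponent_sha_eq_of_isIsogenous hiso hirr]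

/-- The conclusion of `DeepUpperAtThree` holds for `W` iff for a `ℚ`-isogenous `W'`, when `E[p]` is
irreducible. [cite: SilvermanAEC2009, Cor. III.4.11 and Cor. VII.7.2] -/
theorem deepUpper_conclusion_iff_of_isIsogenous :
    (∃ d : ℕ, kuriharaPartialDeepInfty W p f = d ∧
        ((padicValNat p (Nat.card (AddCommGroup.primaryComponent W.sha p)) + d : ℕ) : ℕ∞) ≤
          kuriharaPartial W p f 0) ↔
      ∃ d : ℕ, kuriharaPartialDeepInfty W' p f = d ∧
        ((padicValNat p (Nat.card (AddCommGroup.primaryComponent W'.sha p)) + d : ℕ) : ℕ∞) ≤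
          kuriharaPartial W' p f 0 := by
  rw [kuriharaPartialDeepInfty_eq_of_isIsogenous f hiso hirr, kuriharaPartial_eq_of_isIsogenous f hiso
    hirr 0, natCard_primaryComponent_sha_eq_of_isIsogenous hiso hirr]

/-- The conclusion of `ShallowEqDeepAtTorsionFree` holds for `W` iff for a `ℚ`-isogenous `W'`, when
`E[p]` is irreducible. [cite: SilvermanAEC2009, Cor. III.4.11 and Cor. VII.7.2] -/
theorem shallowEqDeep_conclusion_iff_of_isIsogenous :
    kuriharaPartialDeepInfty W p f ≤ kuriharaPartialInfty W p f ↔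
      kuriharaPartialDeepInfty W' p f ≤ kuriharaPartialInfty W' p f := by
  rw [kuriharaPartialDeepInfty_eq_of_isIsogenous f hiso hirr,
    kuriharaPartialInfty_eq_of_isIsogenous f hiso hirr]

omit [W.IsGloballyMinimal] [W'.IsGloballyMinimal] hirr in
/-- **Additive reduction at `p` (`Addv`, the reduction-type binder of the cell's Kato-stratum rungs)
is a `ℚ`-isogeny invariant**: good reduction (*AEC* VII.7.2) and multiplicative reduction (§C.16,
tree `hasMultiplicativeReductionAtPrime_of_isIsogenous`) both are. [cite: SilvermanAEC2009, Cor. VII.7.2 and §C.16] -/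
theorem addv_iff_of_isIsogenous : Rank1Residual.Addv W p ↔ Rank1Residual.Addv W' p := by
  unfold Rank1Residual.Addv
  rw [hiso.hasGoodReductionAtPrime_iff p]
  exact and_congr_right fun _ => not_congr
    ⟨Summit.BirchSwinnertonDyer.Rank1Residual.X2.IsogenyQuotientLine.hasMultiplicativeReductionAtPrime_of_isIsogenous
        hiso,
      Summit.BirchSwinnertonDyer.Rank1Residual.X2.IsogenyQuotientLine.hasMultiplicativeReductionAtPrime_of_isIsogenous
        hiso.symm_of_charZero⟩

end Transport

/-! ### §2 Every `(W, f)` has an optimal parametrised isogeny-class mate with the same newform -/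

/-- **The optimal datum of the class at the level of `f`.** For an elliptic `W/ℚ` with newform
`f ∈ S₂(Γ₀(N))`: there are a globally minimal elliptic `W₀`, `ℚ`-isogenous to `W`, and a
parametrisation datum `D₀` of `W₀` at level `N` with newform `f`, lattice-optimal
(`Λ_{W₀} = c₀ · Λ_f`) and of minimal modular degree among the data with newform `f` at level `N`
(BCDT for the datum of `W`; Edixhoven 1991 Prop. 2 for `c₀ ∈ ℤ` on the minimal model of the optimal
curve; tree `exists_optimalDatum_of_edixhoven`). [cite: EdixhovenManin1991, Prop. 2]
[cite: AgasheRibetStein2006, Thm. 2.2] -/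
theorem exists_optimalDatum_of_isNewformOf {W : WeierstrassCurve ℚ} [W.IsElliptic] {N : ℕ} [NeZero N]
    {f : CuspForm (Gamma0 N) 2} (hf : IsNewformOf W f) :
    ∃ (W₀ : WeierstrassCurve ℚ) (_ : W₀.IsElliptic) (_ : W₀.IsGloballyMinimal)
      (D₀ : ModularParametrizationData W₀ N), D₀.f = f ∧ W.IsIsogenous W₀ ∧
        (∀ z ∈ D₀.L.lattice, ∃ w ∈ periodLattice D₀.f, z = D₀.c * w) ∧
        ∀ (W₂ : WeierstrassCurve ℚ) [W₂.IsElliptic] (D₂ : ModularParametrizationData W₂ N),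
          D₂.f = D₀.f → D₀.modularDegree ≤ D₂.modularDegree := by
  obtain ⟨D⟩ := nonempty_modularParametrizationData_of_isNewformOf hf
  have hDf : D.f = f := D.isNewformOf.unique hf
  obtain ⟨W₀, hW₀, hW₀', D₀, hf₀, hiso, hopt, hdeg⟩ := D.exists_optimalDatum_of_edixhoven
    (fun hf' hL' q hq hq' ↦ edixhoven_int_of_neronLattice_eq_smul_periodLattice_holds hf' hL' q hq hq')
  exact ⟨W₀, hW₀, hW₀', D₀, hf₀.trans hDf, hiso, hopt, hdeg⟩

/-! ### §3 The cruxes follow from their restrictions to optimal data -/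

section Cruxes

/-- **Crux `DeepLowerAtThree` (item 19075) ⟸ its restriction to OPTIMAL parametrised curves.** If the
rigidity conclusion `∂^{(0)}(δ̃) ≤ ord₃ #Ш(3) + ∂^{(∞)}_{deep}` holds for every globally minimal `W₀`
with the `3`-adic tower onto and `Ш` finite, at the newform `D₀.f` of a lattice-optimal,
degree-minimal parametrisation datum `D₀` (any level), under the crux's plus-symbol integrality and
`ord(δ̃) = 0`, then it holds for EVERY tower-onto `W` and every newform `f` of `W` — transport along
the prime-to-`3` isogeny `W ~ W₀`. [cite: Kim2025RefinedTNC, Thm. 1.1/1.2] [cite: EdixhovenManin1991, Prop. 2] -/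
theorem deepLowerAtThree_of_forall_optimalDatum
    (h : ∀ (W₀ : WeierstrassCurve ℚ) [W₀.IsElliptic] [W₀.IsGloballyMinimal],
      (∀ n : ℕ, W₀.HasSurjectiveModNGaloisRep (3 ^ n : ℕ)) → Finite W₀.sha →
      ∀ {N : ℕ} [NeZero N] (D₀ : ModularParametrizationData W₀ N),
        (∀ z ∈ D₀.L.lattice, ∃ w ∈ periodLattice D₀.f, z = D₀.c * w) →
        (∀ (W₂ : WeierstrassCurve ℚ) [W₂.IsElliptic] (D₂ : ModularParametrizationData W₂ N),
          D₂.f = D₀.f → D₀.modularDegree ≤ D₂.modularDegree) →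
        (∀ r : ℚ, ratPlusSymbol D₀.f r ≠ 0 → 0 ≤ padicValRat 3 (ratPlusSymbol D₀.f r)) →
        kuriharaVanishingOrder W₀ 3 D₀.f = 0 →
        ∃ d : ℕ, kuriharaPartialDeepInfty W₀ 3 D₀.f = d ∧ kuriharaPartial W₀ 3 D₀.f 0 ≤
          ((padicValNat 3 (Nat.card (AddCommGroup.primaryComponent W₀.sha 3)) + d : ℕ) : ℕ∞)) :
    DeepLowerAtThree := by
  intro W _ _ htow hfin N _ f hf hint hord
  haveI : Fact (Nat.Prime 3) := ⟨Nat.prime_three⟩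
  have hirr : W.HasIrreducibleModPGaloisRep 3 := hasIrreducibleModPGaloisRep_of_tower htow
  obtain ⟨W₀, hW₀, hW₀', D₀, hf₀, hiso, hopt, hdeg⟩ := exists_optimalDatum_of_isNewformOf hf
  have h₀ := h W₀ (towerSurjective_of_isIsogenous hiso htow)
    ((finite_sha_iff_of_isIsogenous hiso).mp hfin) D₀ hopt hdeg (by rw [hf₀]; exact hint)
    (by rw [hf₀, ← kuriharaVanishingOrder_eq_of_isIsogenous f hiso hirr]; exact hord)
  rw [hf₀] at h₀
  exact (deepLower_conclusion_iff_of_isIsogenous f hiso hirr).mpr h₀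

/-- **Crux `DeepUpperAtThree` (item 19076) ⟸ its restriction to OPTIMAL parametrised curves** (same
transport). [cite: Kim2025RefinedTNC, Thm. 1.1/1.2] [cite: EdixhovenManin1991, Prop. 2] -/
theorem deepUpperAtThree_of_forall_optimalDatum
    (h : ∀ (W₀ : WeierstrassCurve ℚ) [W₀.IsElliptic] [W₀.IsGloballyMinimal],
      (∀ n : ℕ, W₀.HasSurjectiveModNGaloisRep (3 ^ n : ℕ)) → Finite W₀.sha →
      ∀ {N : ℕ} [NeZero N] (D₀ : ModularParametrizationData W₀ N),
        (∀ z ∈ D₀.L.lattice, ∃ w ∈ periodLattice D₀.f, z = D₀.c * w) →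
        (∀ (W₂ : WeierstrassCurve ℚ) [W₂.IsElliptic] (D₂ : ModularParametrizationData W₂ N),
          D₂.f = D₀.f → D₀.modularDegree ≤ D₂.modularDegree) →
        (∀ r : ℚ, ratPlusSymbol D₀.f r ≠ 0 → 0 ≤ padicValRat 3 (ratPlusSymbol D₀.f r)) →
        kuriharaVanishingOrder W₀ 3 D₀.f = 0 →
        ∃ d : ℕ, kuriharaPartialDeepInfty W₀ 3 D₀.f = d ∧
          ((padicValNat 3 (Nat.card (AddCommGroup.primaryComponent W₀.sha 3)) + d : ℕ) : ℕ∞) ≤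
            kuriharaPartial W₀ 3 D₀.f 0) :
    DeepUpperAtThree := by
  intro W _ _ htow hfin N _ f hf hint hord
  haveI : Fact (Nat.Prime 3) := ⟨Nat.prime_three⟩
  have hirr : W.HasIrreducibleModPGaloisRep 3 := hasIrreducibleModPGaloisRep_of_tower htow
  obtain ⟨W₀, hW₀, hW₀', D₀, hf₀, hiso, hopt, hdeg⟩ := exists_optimalDatum_of_isNewformOf hf
  have h₀ := h W₀ (towerSurjective_of_isIsogenous hiso htow)
    ((finite_sha_iff_of_isIsogenous hiso).mp hfin) D₀ hopt hdeg (by rw [hf₀]; exact hint)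
    (by rw [hf₀, ← kuriharaVanishingOrder_eq_of_isIsogenous f hiso hirr]; exact hord)
  rw [hf₀] at h₀
  exact (deepUpper_conclusion_iff_of_isIsogenous f hiso hirr).mpr h₀

/-- **Crux `ShallowEqDeepAtTorsionFree` (item 19077) ⟸ its restriction to OPTIMAL parametrised
curves** (same transport; the local torsion binder `#E(ℚ₃)[3] = 1` moves by
`natCard_torsion_padic_eq_of_isIsogenous`). [cite: Kim2025RefinedTNC, Thm. 1.1/1.2] [cite: EdixhovenManin1991, Prop. 2] -/
theorem shallowEqDeepAtTorsionFree_of_forall_optimalDatum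
    (h : ∀ (W₀ : WeierstrassCurve ℚ) [W₀.IsElliptic] [W₀.IsGloballyMinimal],
      (∀ n : ℕ, W₀.HasSurjectiveModNGaloisRep (3 ^ n : ℕ)) →
      Nat.card {Q : (W₀.baseChange ℚ_[3]).toAffine.Point // (3 : ℕ) • Q = 0} = 1 → Finite W₀.sha →
      ∀ {N : ℕ} [NeZero N] (D₀ : ModularParametrizationData W₀ N),
        (∀ z ∈ D₀.L.lattice, ∃ w ∈ periodLattice D₀.f, z = D₀.c * w) →
        (∀ (W₂ : WeierstrassCurve ℚ) [W₂.IsElliptic] (D₂ : ModularParametrizationData W₂ N),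
          D₂.f = D₀.f → D₀.modularDegree ≤ D₂.modularDegree) →
        (∀ r : ℚ, ratPlusSymbol D₀.f r ≠ 0 → 0 ≤ padicValRat 3 (ratPlusSymbol D₀.f r)) →
        kuriharaVanishingOrder W₀ 3 D₀.f = 0 →
        kuriharaPartialDeepInfty W₀ 3 D₀.f ≤ kuriharaPartialInfty W₀ 3 D₀.f) :
    ShallowEqDeepAtTorsionFree := by
  intro W _ _ htow ht0 hfin N _ f hf hint hord
  haveI : Fact (Nat.Prime 3) := ⟨Nat.prime_three⟩
  have hirr : W.HasIrreducibleModPGaloisRep 3 := hasIrreducibleModPGaloisRep_of_tower htow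
  obtain ⟨W₀, hW₀, hW₀', D₀, hf₀, hiso, hopt, hdeg⟩ := exists_optimalDatum_of_isNewformOf hf
  have ht0₀ : Nat.card {Q : (W₀.baseChange ℚ_[3]).toAffine.Point // (3 : ℕ) • Q = 0} = 1 := by
    rw [← natCard_torsion_padic_eq_of_isIsogenous hiso hirr]
    exact ht0
  have h₀ := h W₀ (towerSurjective_of_isIsogenous hiso htow) ht0₀
    ((finite_sha_iff_of_isIsogenous hiso).mp hfin) D₀ hopt hdeg (by rw [hf₀]; exact hint)
    (by rw [hf₀, ← kuriharaVanishingOrder_eq_of_isIsogenous f hiso hirr]; exact hord)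
  rw [hf₀] at h₀
  exact (shallowEqDeep_conclusion_iff_of_isIsogenous f hiso hirr).mpr h₀

/-! ### §4 The same at the CONDUCTOR level (Carayol), the shape of the cell's rungs

The Kato-stratum / END rungs of the cell take a datum `D : ModularParametrizationData W N` together
with `hN : N = W.conductorNorm ℤ`. Granted Carayol's theorem «level of the newform = conductor»
(tree NAMED FACT `IsNewformOf.level_eq_conductorNorm`, binder `hlev` as in the cell's other files),
the optimal-datum reductions may assume `N = N_{W₀}` as well. -/

/-- `DeepLowerAtThree` ⟸ its restriction to optimal data AT THE CONDUCTOR, granted Carayol (`hlev`).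
[cite: Carayol1986] [cite: Kim2025RefinedTNC, Thm. 1.1/1.2] -/
theorem deepLowerAtThree_of_forall_optimalDatum_atConductor
    (hlev : ∀ (N : ℕ) [NeZero N], IsNewformOf.level_eq_conductorNorm (N := N))
    (h : ∀ (W₀ : WeierstrassCurve ℚ) [W₀.IsElliptic] [W₀.IsGloballyMinimal],
      (∀ n : ℕ, W₀.HasSurjectiveModNGaloisRep (3 ^ n : ℕ)) → Finite W₀.sha →
      ∀ {N : ℕ} [NeZero N], N = W₀.conductorNorm ℤ → ∀ (D₀ : ModularParametrizationData W₀ N),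
        (∀ z ∈ D₀.L.lattice, ∃ w ∈ periodLattice D₀.f, z = D₀.c * w) →
        (∀ (W₂ : WeierstrassCurve ℚ) [W₂.IsElliptic] (D₂ : ModularParametrizationData W₂ N),
          D₂.f = D₀.f → D₀.modularDegree ≤ D₂.modularDegree) →
        (∀ r : ℚ, ratPlusSymbol D₀.f r ≠ 0 → 0 ≤ padicValRat 3 (ratPlusSymbol D₀.f r)) →
        kuriharaVanishingOrder W₀ 3 D₀.f = 0 →
        ∃ d : ℕ, kuriharaPartialDeepInfty W₀ 3 D₀.f = d ∧ kuriharaPartial W₀ 3 D₀.f 0 ≤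
          ((padicValNat 3 (Nat.card (AddCommGroup.primaryComponent W₀.sha 3)) + d : ℕ) : ℕ∞)) :
    DeepLowerAtThree :=
  deepLowerAtThree_of_forall_optimalDatum fun W₀ _ _ htow hfin _ _ D₀ hopt hdeg hint hord =>
    h W₀ htow hfin (hlev _ D₀.isNewformOf) D₀ hopt hdeg hint hord

/-- `DeepUpperAtThree` ⟸ its restriction to optimal data AT THE CONDUCTOR, granted Carayol (`hlev`).
[cite: Carayol1986] [cite: Kim2025RefinedTNC, Thm. 1.1/1.2] -/
theorem deepUpperAtThree_of_forall_optimalDatum_atConductor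
    (hlev : ∀ (N : ℕ) [NeZero N], IsNewformOf.level_eq_conductorNorm (N := N))
    (h : ∀ (W₀ : WeierstrassCurve ℚ) [W₀.IsElliptic] [W₀.IsGloballyMinimal],
      (∀ n : ℕ, W₀.HasSurjectiveModNGaloisRep (3 ^ n : ℕ)) → Finite W₀.sha →
      ∀ {N : ℕ} [NeZero N], N = W₀.conductorNorm ℤ → ∀ (D₀ : ModularParametrizationData W₀ N),
        (∀ z ∈ D₀.L.lattice, ∃ w ∈ periodLattice D₀.f, z = D₀.c * w) →
        (∀ (W₂ : WeierstrassCurve ℚ) [W₂.IsElliptic] (D₂ : ModularParametrizationData W₂ N),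
          D₂.f = D₀.f → D₀.modularDegree ≤ D₂.modularDegree) →
        (∀ r : ℚ, ratPlusSymbol D₀.f r ≠ 0 → 0 ≤ padicValRat 3 (ratPlusSymbol D₀.f r)) →
        kuriharaVanishingOrder W₀ 3 D₀.f = 0 →
        ∃ d : ℕ, kuriharaPartialDeepInfty W₀ 3 D₀.f = d ∧
          ((padicValNat 3 (Nat.card (AddCommGroup.primaryComponent W₀.sha 3)) + d : ℕ) : ℕ∞) ≤
            kuriharaPartial W₀ 3 D₀.f 0) :
    DeepUpperAtThree :=
  deepUpperAtThree_of_forall_optimalDatum fun W₀ _ _ htow hfin _ _ D₀ hopt hdeg hint hord =>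
    h W₀ htow hfin (hlev _ D₀.isNewformOf) D₀ hopt hdeg hint hord

/-- `ShallowEqDeepAtTorsionFree` ⟸ its restriction to optimal data AT THE CONDUCTOR, granted Carayol
(`hlev`). [cite: Carayol1986] [cite: Kim2025RefinedTNC, Thm. 1.1/1.2] -/
theorem shallowEqDeepAtTorsionFree_of_forall_optimalDatum_atConductor
    (hlev : ∀ (N : ℕ) [NeZero N], IsNewformOf.level_eq_conductorNorm (N := N))
    (h : ∀ (W₀ : WeierstrassCurve ℚ) [W₀.IsElliptic] [W₀.IsGloballyMinimal],
      (∀ n : ℕ, W₀.HasSurjectiveModNGaloisRep (3 ^ n : ℕ)) →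
      Nat.card {Q : (W₀.baseChange ℚ_[3]).toAffine.Point // (3 : ℕ) • Q = 0} = 1 → Finite W₀.sha →
      ∀ {N : ℕ} [NeZero N], N = W₀.conductorNorm ℤ → ∀ (D₀ : ModularParametrizationData W₀ N),
        (∀ z ∈ D₀.L.lattice, ∃ w ∈ periodLattice D₀.f, z = D₀.c * w) →
        (∀ (W₂ : WeierstrassCurve ℚ) [W₂.IsElliptic] (D₂ : ModularParametrizationData W₂ N),
          D₂.f = D₀.f → D₀.modularDegree ≤ D₂.modularDegree) →
        (∀ r : ℚ, ratPlusSymbol D₀.f r ≠ 0 → 0 ≤ padicValRat 3 (ratPlusSymbol D₀.f r)) →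
        kuriharaVanishingOrder W₀ 3 D₀.f = 0 →
        kuriharaPartialDeepInfty W₀ 3 D₀.f ≤ kuriharaPartialInfty W₀ 3 D₀.f) :
    ShallowEqDeepAtTorsionFree :=
  shallowEqDeepAtTorsionFree_of_forall_optimalDatum
    fun W₀ _ _ htow ht0 hfin _ _ D₀ hopt hdeg hint hord =>
      h W₀ htow ht0 hfin (hlev _ D₀.isNewformOf) D₀ hopt hdeg hint hord

end Cruxes

end Summit.BirchSwinnertonDyer.BirchSwinnertonDyer.Theorems.KimAtThreeKolyvaginIsogenyCruxes

end
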